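import Literature.Computability.Cryptography.QuantumCircuit
import HarnessLib

/-!
# Circuits that keep a register classical: no interference between its branches, so event probabilities AVERAGE over it

Topic `Literature/Computability/QuantumComplexity` (circuit model of `Cryptography/QuantumCircuit.lean`). A standard
device for running a quantum algorithm "with a uniformly random classical parameter `key`" inside ONE circuit is to
write `key` on a register by Hadamards and to use that register only as a CONTROL — in particular only as QUERY wires
of oracle gates (the XOR query `|q, b⟩ ↦ |q, b ⊕ [q ∈ A]⟩` leaves its query wires unchanged; Nielsen–Chuang 2010,
§6.1.1) or not at all. The circuit's unitary `U` is then block-diagonal in the computational basis of that register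
("deferred measurement": a control register may be measured before or after, Nielsen–Chuang 2010, §4.4, Exercise 4.35),
and the probability of any measurement event on the input `Σ_key c·|key⟩|rest_key⟩` is `|c|²` times the SUM over `key`
of the event probabilities on the branch inputs `|key⟩|rest_key⟩` — the branches do not interfere because `U` maps
them to vectors with disjoint supports. With `c = 2^{-κ/2}` this is the AVERAGE over the `2^κ` keys (e.g. the
key-average of the acceptance probability of an oracle algorithm run on a `k`-wise independent hash function in
place of a random oracle, Zhandry 2012).

* `KeyDiagonal s U` — the matrix `U` on `N` wires preserves the classical content of the wires `s : Fin κ ↪ Fin N`: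
  `U x y = 0` unless `x ∘ s = y ∘ s`;
* closure: `KeyDiagonal.one`, `.mul`, `.placeGate_of_forall_ne` (a gate placed OFF the key wires),
  **`.placeGate_oracleGate`** (an oracle gate whose ANSWER wire is off the key wires — its query wires may be key
  wires), `.toMatrix_gate/oracle`, **`.circuit`** (a gate list all of whose gates are such);
* `KeyDiagonal.mulVec_eq_zero_of_supported` — `U` maps vectors supported on `{x | x ∘ s = key}` to vectors supported
  there;
* **`KeyDiagonal.normSq_apply_mulVec_sum`** — pointwise no-interference:
  `|(U (Σ_key c·|z_key⟩))(y)|² = Σ_key |(U (c·|z_key⟩))(y)|²` for basis inputs `z_key` reading `key` on `s`;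
* **`KeyDiagonal.sum_normSq_mulVec_sum`** — for every finite event `E`:
  `Σ_{y∈E} |(U (Σ_key c·|z_key⟩))(y)|² = |c|² · Σ_key Σ_{y∈E} |(U |z_key⟩)(y)|²`.

Everything here is PROVED; one definition (`KeyDiagonal`, a `Prop`). Deliberately NOT here: the Hadamard layer
producing `2^{-κ/2} Σ_key |key⟩` from `|0^κ⟩` (its matrix bookkeeping belongs with the user's layout), and any
uniformity statement.

## References

* M. A. Nielsen, I. L. Chuang, *Quantum Computation and Quantum Information*, CUP 2010, §4.4 (principle of deferred
  measurement, Exercise 4.35), §6.1.1 (the oracle as `|x⟩|q⟩ ↦ |x⟩|q ⊕ f(x)⟩`), §2.2.5 (Born rule) [NielsenChuang2010].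
* M. Zhandry, *Secure identity-based encryption in the quantum random oracle model*, CRYPTO 2012 (arXiv:1204.0629),
  Thm. 3.1 (k-wise independent functions simulate a random oracle for `T`-query algorithms, `k = 2T`; the simulation
  runs the algorithm on a random member of the family) [Zhandry2012].
-/

noncomputable section

namespace Literature.Computability.QuantumComplexity

open Cryptography Matrix Finset

variable {N κ : ℕ}

/-- **`U` keeps the wires `s` classical**: the matrix `U` on `N` wires has no entry between basis states that
differ on the key wires `s : Fin κ ↪ Fin N` (`U` is block-diagonal in the computational basis of the key register).
[cite: NielsenChuang2010, §4.4 (deferred measurement: controls may be treated classically)] -/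
def KeyDiagonal (s : Fin κ ↪ Fin N) (U : Matrix (QReg N) (QReg N) ℂ) : Prop :=
  ∀ x y : QReg N, x ∘ s ≠ y ∘ s → U x y = 0

namespace KeyDiagonal

variable {s : Fin κ ↪ Fin N}

/-- The identity keeps every register classical. [cite: NielsenChuang2010, §4.4] -/
theorem one : KeyDiagonal s (1 : Matrix (QReg N) (QReg N) ℂ) := by
  intro x y hxy
  rw [Matrix.one_apply, if_neg]
  rintro rfl
  exact hxy rfl

/-- Products of key-diagonal matrices are key-diagonal. [cite: NielsenChuang2010, §4.4] -/
theorem mul {U V : Matrix (QReg N) (QReg N) ℂ} (hU : KeyDiagonal s U) (hV : KeyDiagonal s V) :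
    KeyDiagonal s (U * V) := by
  intro x y hxy
  rw [Matrix.mul_apply]
  refine Finset.sum_eq_zero fun w _ => ?_
  by_cases h1 : x ∘ s = w ∘ s
  · have h2 : w ∘ s ≠ y ∘ s := fun h => hxy (h1.trans h)
    rw [hV w y h2, mul_zero]
  · rw [hU x w h1, zero_mul]

/-- A gate placed on wires all different from the key wires is key-diagonal. [cite: NielsenChuang2010, §4.3 (a gate acts as the identity off its wires)] -/
theorem placeGate_of_forall_ne {k : ℕ} (e : Fin k ↪ Fin N) (V : Matrix (QReg k) (QReg k) ℂ)
    (h : ∀ i j, e i ≠ s j) : KeyDiagonal s (placeGate e V) := by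
  intro x y hxy
  rw [placeGate_apply]
  split_ifs with hagree
  · exfalso
    refine hxy (funext fun j => hagree (s j) ?_)
    rintro ⟨i, hi⟩
    exact h i j hi
  · rfl

/-- **An oracle gate whose ANSWER wire is not a key wire is key-diagonal** — its query wires may well be key wires:
the XOR query leaves them unchanged. [cite: NielsenChuang2010, §6.1.1 (the oracle |x⟩|q⟩ ↦ |x⟩|q ⊕ f(x)⟩)] -/
theorem placeGate_oracleGate {k : ℕ} (e : Fin (k + 1) ↪ Fin N) (A : Language Bool)
    (h : ∀ j, e (Fin.last k) ≠ s j) : KeyDiagonal s (placeGate e (oracleGate A k)) := by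
  intro x y hxy
  rw [placeGate_apply]
  split_ifs with hagree
  · unfold oracleGate
    rw [Matrix.of_apply]
    split_ifs with hq
    · exfalso
      refine hxy (funext fun j => ?_)
      by_cases hr : s j ∈ Set.range e
      · obtain ⟨i, hi⟩ := hr
        rcases Fin.eq_castSucc_or_eq_last i with ⟨i', rfl⟩ | rfl
        · have := hq.1 i'
          simp only [Function.comp_apply] at this ⊢
          rw [← hi]
          exact this
        · exact absurd hi (h j)
      · exact hagree _ hr
    · rfl
  · rfl

variable {G : QGateSet}

/-- A placed gate symbol off the key wires is key-diagonal. [cite: NielsenChuang2010, §4.3] -/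
theorem toMatrix_gate (A : Language Bool) (g : G.Op) (e : Fin (G.arity g) ↪ Fin N) (h : ∀ i j, e i ≠ s j) :
    KeyDiagonal s ((QGate.gate g e : QGate G N).toMatrix A) := by
  rw [QGate.toMatrix_gate]
  exact placeGate_of_forall_ne e _ h

/-- A placed oracle query with answer wire off the key wires is key-diagonal. [cite: NielsenChuang2010, §6.1.1] -/
theorem toMatrix_oracle (A : Language Bool) (k : ℕ) (e : Fin (k + 1) ↪ Fin N) (h : ∀ j, e (Fin.last k) ≠ s j) :
    KeyDiagonal s ((QGate.oracle k e : QGate G N).toMatrix A) := by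
  rw [QGate.toMatrix_oracle]
  exact placeGate_oracleGate e A h

/-- **A circuit all of whose gates are key-diagonal is key-diagonal.** [cite: NielsenChuang2010, §4.4] -/
theorem circuit (A : Language Bool) :
    ∀ gs : List (QGate G N), (∀ g ∈ gs, KeyDiagonal s (g.toMatrix A)) →
      KeyDiagonal s ((⟨gs⟩ : QCircuit G N).toMatrix A)
  | [], _ => by rw [QCircuit.toMatrix_nil]; exact one
  | g :: gs, hgs => by
    rw [QCircuit.toMatrix_cons]
    exact mul (circuit A gs fun g' hg' => hgs g' (List.mem_cons_of_mem _ hg'))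
      (hgs g (List.mem_cons_self ..))

/-! ### No interference between the branches of the key register -/

/-- A key-diagonal matrix maps a vector supported on the branch `{x | x ∘ s = key}` to a vector supported there.
[cite: NielsenChuang2010, §4.4] -/
theorem mulVec_eq_zero_of_supported {U : Matrix (QReg N) (QReg N) ℂ} (hU : KeyDiagonal s U)
    {ψ : QReg N → ℂ} {key : QReg κ} (hψ : ∀ x, x ∘ s ≠ key → ψ x = 0) {y : QReg N} (hy : y ∘ s ≠ key) :
    (U *ᵥ ψ) y = 0 := by
  rw [Matrix.mulVec, dotProduct]
  refine Finset.sum_eq_zero fun x _ => ?_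
  by_cases hx : x ∘ s = key
  · rw [hU y x (by rw [hx]; exact hy), zero_mul]
  · rw [hψ x hx, mul_zero]

/-- The branch of a scaled basis state. [folklore] -/
private theorem smul_basisState_eq_zero {z x : QReg N} {c : ℂ} (h : x ≠ z) : c * basisState z x = 0 := by
  rw [basisState_apply, if_neg h, mul_zero]

/-- On the branch `key`, only the summand `key` of `U (Σ_key c·|z_key⟩)` survives. [cite: NielsenChuang2010, §4.4] -/
theorem mulVec_sum_apply {U : Matrix (QReg N) (QReg N) ℂ} (hU : KeyDiagonal s U)
    (z : QReg κ → QReg N) (hz : ∀ key, z key ∘ s = key) (c : ℂ) (y : QReg N) :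
    (U *ᵥ fun x => ∑ key, c * basisState (z key) x) y = (U *ᵥ fun x => c * basisState (z (y ∘ s)) x) y := by
  have hlin : (U *ᵥ fun x => ∑ key, c * basisState (z key) x) =
      ∑ key, U *ᵥ fun x => c * basisState (z key) x := by
    have e : (fun x => ∑ key, c * basisState (z key) x) = ∑ key, fun x => c * basisState (z key) x := by
      funext x; simp [Finset.sum_apply]
    rw [e, Matrix.mulVec_sum]
  rw [hlin, Finset.sum_apply, Finset.sum_eq_single (y ∘ s)]
  · intro key _ hkey
    refine mulVec_eq_zero_of_supported hU (key := key) (fun x hx => ?_) (Ne.symm hkey)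
    exact smul_basisState_eq_zero fun hxz => hx (by rw [hxz, hz key])
  · intro h
    exact absurd (Finset.mem_univ _) h

/-- **Pointwise no-interference**: `|(U (Σ_key c·|z_key⟩))(y)|² = Σ_key |(U (c·|z_key⟩))(y)|²` for basis inputs
`z_key` reading `key` on the key wires and `U` key-diagonal (each output basis state receives amplitude from exactly
one branch). [cite: NielsenChuang2010, §4.4 (deferred measurement)] -/
theorem normSq_apply_mulVec_sum {U : Matrix (QReg N) (QReg N) ℂ} (hU : KeyDiagonal s U)
    (z : QReg κ → QReg N) (hz : ∀ key, z key ∘ s = key) (c : ℂ) (y : QReg N) :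
    ‖(U *ᵥ fun x => ∑ key, c * basisState (z key) x) y‖ ^ 2 =
      ∑ key, ‖(U *ᵥ fun x => c * basisState (z key) x) y‖ ^ 2 := by
  rw [mulVec_sum_apply hU z hz c y, Finset.sum_eq_single (y ∘ s)]
  · intro key _ hkey
    rw [mulVec_eq_zero_of_supported hU (key := key) (fun x hx => ?_) (Ne.symm hkey)]
    · simp
    · exact smul_basisState_eq_zero fun hxz => hx (by rw [hxz, hz key])
  · intro h
    exact absurd (Finset.mem_univ _) h

/-- Scaling a basis input scales the output amplitude (linearity). [cite: NielsenChuang2010, §2.2.5 (Born rule: probabilities are squared amplitudes)] -/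
theorem normSq_apply_mulVec_smul (U : Matrix (QReg N) (QReg N) ℂ) (z : QReg N) (c : ℂ) (y : QReg N) :
    ‖(U *ᵥ fun x => c * basisState z x) y‖ ^ 2 = ‖c‖ ^ 2 * ‖(U *ᵥ basisState z) y‖ ^ 2 := by
  have e : (fun x => c * basisState z x) = c • basisState z := by
    funext x; simp [Pi.smul_apply, smul_eq_mul]
  rw [e, Matrix.mulVec_smul, Pi.smul_apply, smul_eq_mul, norm_mul, mul_pow]

/-- **Event probabilities average over the key register.** For `U` key-diagonal, basis inputs `z_key` reading
`key` on the key wires and any finite event `E`: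
`Σ_{y∈E} |(U (Σ_key c·|z_key⟩))(y)|² = |c|² · Σ_key Σ_{y∈E} |(U |z_key⟩)(y)|²`; with `c = 2^{-κ/2}` (the state a layer
of Hadamards writes on `|0^κ⟩`) the right-hand side is the AVERAGE over the `2^κ` keys of the branch probabilities.
[cite: NielsenChuang2010, §4.4 (deferred measurement) and §2.2.5 (Born rule)] [cite: Zhandry2012, Thm. 3.1 (run the algorithm on a random member of the family)] -/
theorem sum_normSq_mulVec_sum {U : Matrix (QReg N) (QReg N) ℂ} (hU : KeyDiagonal s U)
    (z : QReg κ → QReg N) (hz : ∀ key, z key ∘ s = key) (c : ℂ) (E : Finset (QReg N)) :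
    ∑ y ∈ E, ‖(U *ᵥ fun x => ∑ key, c * basisState (z key) x) y‖ ^ 2 =
      ‖c‖ ^ 2 * ∑ key, ∑ y ∈ E, ‖(U *ᵥ basisState (z key)) y‖ ^ 2 := by
  rw [Finset.sum_comm, Finset.mul_sum]
  refine Finset.sum_congr rfl fun y _ => ?_
  rw [normSq_apply_mulVec_sum hU z hz c y, Finset.mul_sum]
  exact Finset.sum_congr rfl fun key _ => normSq_apply_mulVec_smul U (z key) c y

end KeyDiagonal

end Literature.Computability.QuantumComplexity

end
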